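import Literature.NumberTheory.Sieve.CFSemigroupCongruencePowerSaving
import HarnessLib

/-!
# The twisted resolvent as an operator: residue, regular part, and the power saving from an operator bound

[MageeOhWinter2019, Thm. 4] bounds the congruence transfer operators `𝓛_{s,q}` (equivalently the resolvent
`(1 − 𝓛_{s,q})^{-1}`) in operator norm on the strip `|Re s − δ| < ε`; §3.4 turns this into the error term of the counting
theorems. `CFSemigroupCongruencePowerSaving.lean` proved the counting conclusion for the congruence renewal count from a bound
on the SCALAR coefficient `D(s) = ((1 − 𝓜_s)^{-1}(G_s ⊗ δ_{ξ₀}))_ξ(x)` minus its pole. Here the hypothesis is lifted to the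
operator level, uniformly in the fibres and the evaluation point:

* `cfTwResOp = (2κ_A)^{-1} · lift(Π)` — the **residue operator** of `(1 − 𝓜_s)^{-1}` at `δ_A` (`Π = ν ⊗ h` the RPF projector,
  `lift` the diagonal action on constants of `SL₂(ℤ/qℤ) → CfLip`);
* `cfTwHop s = (1 − 𝓜_s)^{-1} − (s − δ_A)^{-1} • cfTwResOp` — the **regular part** (genuinely regular: off `δ_A` it is the
  resolvent minus the pole, cf. `cfCongRes_decomp`);
* `cfCongRes_eq_cfTwHop`: `D(s) = (cfTwHop s (G_s ⊗ δ_{ξ₀}))_ξ(x) + (s−δ_A)^{-1} (2κ_A|Γ_q|)^{-1} ν(G_s) h(x)`, and the residue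
  `r = (2κ_A|Γ_q|)^{-1} ν(G_{δ_A}) h(x)` (`cfCongResid_eq_residue`), so that
  `D(s) − r/(s−δ_A) = (cfTwHop s (G_s ⊗ δ_{ξ₀}))_ξ(x) + (2κ_A|Γ_q|)^{-1} h(x) (ν(G_s) − ν(G_{δ_A}))/(s − δ_A)`, where the last
  term is bounded by `2Λ‖G‖ e^{2δ_A}/(2κ_A)` for `Re s ≥ 0` (`norm_cfNuL_cfPowFam_sub_le`, mean value theorem for `w ↦ e^{-2wψ}`).

**Theorem** (`cfCongCountT_powerSaving_of_operatorBound`): under the unit hypotheses of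
`cfCongCountT_powerSaving_of_resolventBound` and the SUP-NORM bound
`‖(cfTwHop (u+it) (G_{u+it} ⊗ δ_{ξ₀}))_η(y)‖ ≤ M (1+|t|)^κ` for all fibres `η`, points `y ∈ [0,1]`, `σ₁ ≤ u ≤ δ_A+1`, `u+it ≠ δ_A`
(`0 ≤ κ < 2`), the power saving for `N_q(X, x; ξ → ξ₀; G, Φ)` holds for EVERY start fibre `ξ` and base point `x` with the same
constants (`M` replaced by `M + Λ‖G‖e^{2δ_A}/κ_A`). This uniformity in `(ξ, x)` is what the passage to the Frobenius-ball count
over all suffixes needs ([MageeOhWinter2019, Lemma 13, (3.8)]); a weighted-norm (Dolgopyat-type) operator bound for `cfTwHop`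
implies the sup-norm hypothesis directly.

## References
* [MageeOhWinter2019] M. Magee, H. Oh, D. Winter, J. reine angew. Math. 753 (2019), §3.2 (3.4), §3.4, Thm. 4.
-/

noncomputable section

open Complex Filter Set Metric Real
open scoped Topology MatrixGroups

namespace Literature.NumberTheory.Sieve

open Literature.NumberTheory.LFunctions

variable {A : Finset ℕ}

section Operator

variable (A) (hA : ∀ a ∈ A, 1 ≤ a) (h2 : 2 ≤ A.card) (q : ℕ) [NeZero q]

/-- **The residue operator** of `(1 − 𝓜_s)^{-1}` at `δ_A`: `(2κ_A)^{-1} · lift(Π)`. [cite: MageeOhWinter2019, §3.2 and Lemma 16] -/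
def cfTwResOp : (SL(2, ZMod q) → CfLip) →L[ℂ] (SL(2, ZMod q) → CfLip) :=
  (((2 * cfInt (cfNuδ A hA h2) (cfG A hA h2) : ℝ) : ℂ))⁻¹ • cfTwLift q (cfPi A hA h2)

/-- **The regular part of the twisted resolvent:** `H_op(s) = (1 − 𝓜_s)^{-1} − (s − δ_A)^{-1} • Res`.
[cite: MageeOhWinter2019, §3.4] -/
def cfTwHop (s : ℂ) : (SL(2, ZMod q) → CfLip) →L[ℂ] (SL(2, ZMod q) → CfLip) :=
  Ring.inverse (1 - cfTwist A hA q s) - (s - cfDimension A)⁻¹ • cfTwResOp A hA h2 q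

variable {A q}

/-- Components of the residue operator on a single-fibre family: `(Res (F ⊗ δ_{ξ₀}))_ξ(x) = (2κ_A|Γ_q|)^{-1} ν(F) h(x)`.
[folklore] -/
theorem cfTwResOp_single_apply (F : CfLip) (ξ ξ₀ : SL(2, ZMod q)) (x : Icc (0 : ℝ) 1) :
    (cfTwResOp A hA h2 q (cfTwSingle q ξ₀ F)) ξ x =
      (((2 * cfInt (cfNuδ A hA h2) (cfG A hA h2) : ℝ) : ℂ))⁻¹ * (((Fintype.card (SL(2, ZMod q)) : ℂ))⁻¹ *
        cfNuL A hA h2 F * (cfHδ A hA h2 x : ℂ)) := by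
  rw [cfTwResOp, show ∀ (c : ℂ) (P : (SL(2, ZMod q) → CfLip) →L[ℂ] (SL(2, ZMod q) → CfLip)) (Fam : SL(2, ZMod q) → CfLip),
      (c • P) Fam = c • P Fam from fun _ _ _ => rfl, Pi.smul_apply, CfLip.smul_apply, cfTwLift_apply, cfTwAv_cfTwSingle,
    map_smul, CfLip.smul_apply, cfPi_apply, CfLip.smul_apply, cfHL_apply]
  ring

/-- **`D = H_op`-part `+` residue part:** `D(s) = (H_op(s) (G_s ⊗ δ_{ξ₀}))_ξ(x) + (s−δ_A)^{-1}(2κ_A|Γ_q|)^{-1} ν(G_s) h(x)`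
(pure algebra: `(1 − 𝓜_s)^{-1} = H_op(s) + (s−δ_A)^{-1} • Res`). [cite: MageeOhWinter2019, §3.4] -/
theorem cfCongRes_eq_cfTwHop (Θ : CfThreshold) (G : CfLip) (ξ ξ₀ : SL(2, ZMod q)) (x : Icc (0 : ℝ) 1) (s : ℂ) :
    cfCongRes q Θ hA G ξ ξ₀ x s = (cfTwHop A hA h2 q s (cfFamS q Θ G ξ₀ s)) ξ x +
      (s - cfDimension A)⁻¹ * ((((2 * cfInt (cfNuδ A hA h2) (cfG A hA h2) : ℝ) : ℂ))⁻¹ *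
        (((Fintype.card (SL(2, ZMod q)) : ℂ))⁻¹ * cfNuL A hA h2 (Θ.cfPowFam G 2 s) * (cfHδ A hA h2 x : ℂ))) := by
  have he : Ring.inverse (1 - cfTwist A hA q s) = cfTwHop A hA h2 q s + (s - cfDimension A)⁻¹ • cfTwResOp A hA h2 q := by
    rw [cfTwHop, sub_add_cancel]
  rw [cfCongRes, he, _root_.add_apply, Pi.add_apply, CfLip.add_apply,
    show ∀ (c : ℂ) (P : (SL(2, ZMod q) → CfLip) →L[ℂ] (SL(2, ZMod q) → CfLip)) (Fam : SL(2, ZMod q) → CfLip),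
      (c • P) Fam = c • P Fam from fun _ _ _ => rfl, Pi.smul_apply, CfLip.smul_apply, cfFamS, cfTwResOp_single_apply,
    ← cfFamS]

/-- **The residue is the value at `δ_A` of the residue part:** `r = (2κ_A|Γ_q|)^{-1} ν(G_{δ_A}) h(x)` (as a complex number).
[folklore] -/
theorem cfCongResid_eq_residue (Θ : CfThreshold) {G : CfLip} (hGre : ∀ y : Icc (0 : ℝ) 1, (((G y).re : ℝ) : ℂ) = G y)
    (x : Icc (0 : ℝ) 1) :
    (cfCongResid q Θ hA h2 G x : ℂ) = (((2 * cfInt (cfNuδ A hA h2) (cfG A hA h2) : ℝ) : ℂ))⁻¹ *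
      (((Fintype.card (SL(2, ZMod q)) : ℂ))⁻¹ * cfNuL A hA h2 (Θ.cfPowFam G 2 (cfDimension A : ℂ)) * (cfHδ A hA h2 x : ℂ)) := by
  have hν : cfNuL A hA h2 (Θ.cfPowFam G 2 (cfDimension A : ℂ)) =
      ((cfInt (cfNuδ A hA h2) (fun y => (G.extend y).re * Θ.Φ y ^ (-(2 * cfDimension A))) : ℝ) : ℂ) := by
    refine cfNuL_of_real A hA h2 (g := fun y => (G.extend y).re * Θ.Φ y ^ (-(2 * cfDimension A))) fun y => ?_
    rw [Θ.cfPowFam_ofReal hGre 2 (cfDimension A) y, CfLip.extend_coe]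
  have hκ : ((cfInt (cfNuδ A hA h2) (cfG A hA h2) : ℝ) : ℂ) ≠ 0 := ofReal_ne_zero.2 (cfInt_cfG_pos A hA h2).ne'
  have hcard : ((Fintype.card (SL(2, ZMod q)) : ℂ)) ≠ 0 := by exact_mod_cast Fintype.card_ne_zero
  rw [hν, cfCongResid]
  push_cast
  field_simp

/-! ### The residue part is Lipschitz in `s` on `Re s ≥ 0` -/

/-- `|e^{-aψ} − e^{-bψ}| ≤ ψ |a − b|` for `ψ ≥ 0` and `Re a, Re b ≥ 0` (mean value theorem). [folklore] -/
theorem norm_cexp_neg_mul_sub_cexp_neg_mul_le {ψ : ℝ} (hψ : 0 ≤ ψ) {a b : ℂ} (ha : 0 ≤ a.re) (hb : 0 ≤ b.re) :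
    ‖Complex.exp (-(a * ψ)) - Complex.exp (-(b * ψ))‖ ≤ ψ * ‖a - b‖ := by
  have hdiff : ∀ w ∈ {w : ℂ | 0 ≤ w.re}, DifferentiableAt ℂ (fun w : ℂ => Complex.exp (-(w * ψ))) w := fun w _ => by
    fun_prop
  have hbound : ∀ w ∈ {w : ℂ | 0 ≤ w.re}, ‖deriv (fun w : ℂ => Complex.exp (-(w * ψ))) w‖ ≤ ψ := by
    intro w hw
    have hd : HasDerivAt (fun w : ℂ => Complex.exp (-(w * ψ))) (Complex.exp (-(w * ψ)) * (-(1 * (ψ : ℂ)))) w :=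
      ((hasDerivAt_id w).mul_const (ψ : ℂ)).neg.cexp
    rw [hd.deriv, norm_mul, Complex.norm_exp, norm_neg, one_mul, Complex.norm_real, Real.norm_eq_abs, abs_of_nonneg hψ]
    have hre : (-(w * (ψ : ℂ))).re = -(w.re * ψ) := by simp
    rw [hre]
    have h1 : Real.exp (-(w.re * ψ)) ≤ 1 := Real.exp_le_one_iff.2 (by nlinarith [hw.out])
    nlinarith [Real.exp_pos (-(w.re * ψ))]
  have h := (convex_halfSpace_re_ge (r := 0)).norm_image_sub_le_of_norm_deriv_le hdiff hbound hb ha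
  simpa using h

/-- **`|ν(G Φ^{-2s}) − ν(G Φ^{-2s'})| ≤ 2Λ‖G‖ |s − s'|`** for `Re s, Re s' ≥ 0` (`ν` a probability measure, `0 ≤ log Φ ≤ Λ`).
[folklore] -/
theorem norm_cfNuL_cfPowFam_sub_le (Θ : CfThreshold) (G : CfLip) {s s' : ℂ} (hs : 0 ≤ s.re) (hs' : 0 ≤ s'.re) :
    ‖cfNuL A hA h2 (Θ.cfPowFam G 2 s) - cfNuL A hA h2 (Θ.cfPowFam G 2 s')‖ ≤ 2 * Θ.Λ * ‖G‖ * ‖s - s'‖ := by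
  rw [← map_sub, cfNuL_apply]
  have hpt : ∀ y : Icc (0 : ℝ) 1, ‖(Θ.cfPowFam G 2 s - Θ.cfPowFam G 2 s') y‖ ≤ 2 * Θ.Λ * ‖G‖ * ‖s - s'‖ := by
    intro y
    rw [CfLip.sub_apply, Θ.cfPowFam_apply, Θ.cfPowFam_apply, ← mul_sub, norm_mul]
    have hψ0 := Θ.log_nonneg y.2
    have hψ1 := Θ.log_le y y.2
    have h1 := norm_cexp_neg_mul_sub_cexp_neg_mul_le hψ0 (a := (2 : ℂ) * s) (b := (2 : ℂ) * s')
      (by simp; linarith) (by simp; linarith)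
    have h2' : ‖(2 : ℂ) * s - 2 * s'‖ = 2 * ‖s - s'‖ := by
      rw [← mul_sub, norm_mul]; norm_num
    rw [h2'] at h1
    push_cast at h1 ⊢
    calc ‖G y‖ * ‖Complex.exp (-(2 * s * (Real.log (Θ.Φ y) : ℂ))) - Complex.exp (-(2 * s' * (Real.log (Θ.Φ y) : ℂ)))‖
        ≤ ‖G‖ * (Real.log (Θ.Φ y) * (2 * ‖s - s'‖)) := mul_le_mul (CfLip.norm_apply_le G y) h1 (norm_nonneg _) (norm_nonneg _)
      _ ≤ ‖G‖ * (Θ.Λ * (2 * ‖s - s'‖)) := by gcongr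
      _ = 2 * Θ.Λ * ‖G‖ * ‖s - s'‖ := by ring
  calc ‖∫ y, (Θ.cfPowFam G 2 s - Θ.cfPowFam G 2 s') y ∂(cfNuδ A hA h2)‖
      ≤ ∫ y, ‖(Θ.cfPowFam G 2 s - Θ.cfPowFam G 2 s') y‖ ∂(cfNuδ A hA h2) := MeasureTheory.norm_integral_le_integral_norm _
    _ ≤ ∫ y, 2 * Θ.Λ * ‖G‖ * ‖s - s'‖ ∂(cfNuδ A hA h2) := by
        refine MeasureTheory.integral_mono_of_nonneg (Eventually.of_forall fun y => norm_nonneg _)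
          (MeasureTheory.integrable_const _) (Eventually.of_forall hpt)
    _ = 2 * Θ.Λ * ‖G‖ * ‖s - s'‖ := by simp

/-- **The scalar hypothesis from the operator hypothesis:** with `C_res = Λ‖G‖ e^{2δ_A}/κ_A`, for `Re s ≥ 0`, `s ≠ δ_A`,
`‖D(s) − r/(s − δ_A)‖ ≤ ‖(H_op(s)(G_s ⊗ δ_{ξ₀}))_ξ(x)‖ + C_res`. [cite: MageeOhWinter2019, §3.4] -/
theorem norm_cfCongRes_sub_le (Θ : CfThreshold) {G : CfLip} (hGre : ∀ y : Icc (0 : ℝ) 1, (((G y).re : ℝ) : ℂ) = G y)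
    (ξ ξ₀ : SL(2, ZMod q)) (x : Icc (0 : ℝ) 1) {s : ℂ} (hs0 : 0 ≤ s.re) (hne : s ≠ (cfDimension A : ℂ)) :
    ‖cfCongRes q Θ hA G ξ ξ₀ x s - (cfCongResid q Θ hA h2 G x : ℂ) / (s - cfDimension A)‖ ≤
      ‖(cfTwHop A hA h2 q s (cfFamS q Θ G ξ₀ s)) ξ x‖ +
        Θ.Λ * ‖G‖ * Real.exp (2 * cfDimension A) / cfInt (cfNuδ A hA h2) (cfG A hA h2) := by
  have hκpos := cfInt_cfG_pos A hA h2
  have hδ := cfDimension_pos hA h2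
  have hsδ : (s - cfDimension A : ℂ) ≠ 0 := sub_ne_zero.2 hne
  set κ₂ : ℂ := (((2 * cfInt (cfNuδ A hA h2) (cfG A hA h2) : ℝ) : ℂ)) with hκ₂
  set cd : ℂ := ((Fintype.card (SL(2, ZMod q)) : ℂ)) with hcd
  have hcd1 : 1 ≤ ‖cd‖ := by
    rw [hcd, Complex.norm_natCast]; exact_mod_cast Fintype.card_pos
  have hκ₂n : ‖κ₂‖ = 2 * cfInt (cfNuδ A hA h2) (cfG A hA h2) := by
    rw [hκ₂, Complex.norm_real, Real.norm_eq_abs, abs_of_pos (by positivity)]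
  -- the algebraic identity
  have hid : cfCongRes q Θ hA G ξ ξ₀ x s - (cfCongResid q Θ hA h2 G x : ℂ) / (s - cfDimension A) =
      (cfTwHop A hA h2 q s (cfFamS q Θ G ξ₀ s)) ξ x +
        (s - cfDimension A)⁻¹ * (κ₂⁻¹ * (cd⁻¹ * (cfNuL A hA h2 (Θ.cfPowFam G 2 s) -
          cfNuL A hA h2 (Θ.cfPowFam G 2 (cfDimension A : ℂ))) * (cfHδ A hA h2 x : ℂ))) := by
    rw [cfCongRes_eq_cfTwHop hA h2 Θ G ξ ξ₀ x s, cfCongResid_eq_residue hA h2 Θ hGre x, div_eq_mul_inv]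
    simp only [hκ₂, hcd]
    ring
  rw [hid]
  refine (norm_add_le _ _).trans (add_le_add le_rfl ?_)
  -- the residue-part difference quotient
  have hν := norm_cfNuL_cfPowFam_sub_le hA h2 Θ G hs0 (s' := (cfDimension A : ℂ)) (by simp [hδ.le])
  have hh : ‖(cfHδ A hA h2 x : ℂ)‖ ≤ Real.exp (2 * cfDimension A) := by
    rw [Complex.norm_real, Real.norm_eq_abs, abs_of_pos (cfHδ_pos A hA h2 x.2)]
    exact cfHδ_le A hA h2 x.2
  rw [norm_mul, norm_mul, norm_mul, norm_mul, norm_inv, norm_inv, norm_inv, hκ₂n]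
  have hsn : 0 < ‖s - (cfDimension A : ℂ)‖ := norm_pos_iff.2 hsδ
  have hΛ : 0 ≤ Θ.Λ := (Θ.log_nonneg (show (0 : ℝ) ∈ Icc (0 : ℝ) 1 from ⟨le_rfl, zero_le_one⟩)).trans
    (Θ.log_le 0 ⟨le_rfl, zero_le_one⟩)
  calc ‖s - (cfDimension A : ℂ)‖⁻¹ * ((2 * cfInt (cfNuδ A hA h2) (cfG A hA h2))⁻¹ * (‖cd‖⁻¹ *
        ‖cfNuL A hA h2 (Θ.cfPowFam G 2 s) - cfNuL A hA h2 (Θ.cfPowFam G 2 (cfDimension A : ℂ))‖ * ‖(cfHδ A hA h2 x : ℂ)‖))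
      ≤ ‖s - (cfDimension A : ℂ)‖⁻¹ * ((2 * cfInt (cfNuδ A hA h2) (cfG A hA h2))⁻¹ * (1 *
        (2 * Θ.Λ * ‖G‖ * ‖s - (cfDimension A : ℂ)‖) * Real.exp (2 * cfDimension A))) := by
        gcongr
        exact inv_le_one_of_one_le₀ hcd1
    _ = Θ.Λ * ‖G‖ * Real.exp (2 * cfDimension A) / cfInt (cfNuδ A hA h2) (cfG A hA h2) := by
        field_simp

/-! ### The power saving from the operator bound -/

/-- **Power saving for the congruence renewal count from an operator bound on the regular part of the twisted resolvent,
uniformly in the fibres and the base point.** Under the unit hypotheses of `cfCongCountT_powerSaving_of_resolventBound`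
and the sup-norm bound `‖(H_op(u+it)(G_{u+it} ⊗ δ_{ξ₀}))_η(y)‖ ≤ M(1+|t|)^κ` for all `η ∈ SL₂(ℤ/qℤ)`, `y ∈ [0,1]`,
`σ₁ ≤ u ≤ δ_A + 1`, `u + it ≠ δ_A` (`0 ≤ κ < 2`), one has for every start fibre `ξ`, base point `x` and `X ≥ √2`
`|N_q(X, x; ξ → ξ₀; G, Φ) − r(x) X^{2δ_A}/δ_A| ≤ (r(x)(2^{δ_A+1} + 1/δ_A) + (M + C_res)·(32/π)·2^{2+σ₁}·S(σ₁,κ)) · X^{2δ_A − 2(δ_A−σ₁)/3}`,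
`C_res = Λ‖G‖e^{2δ_A}/κ_A`. [cite: MageeOhWinter2019, §3.4 (Lemma 15, Lemma 16, Prop. 17) and Thm. 4] -/
theorem cfCongCountT_powerSaving_of_operatorBound (Θ : CfThreshold) {G : CfLip}
    (hGre : ∀ y : Icc (0 : ℝ) 1, (((G y).re : ℝ) : ℂ) = G y) (hG0 : ∀ y : Icc (0 : ℝ) 1, 0 ≤ (G y).re)
    (ξ₀ : SL(2, ZMod q)) {σ₀ σ₁ : ℝ} (hσ₀ : 0 ≤ σ₀) (hσ₀₁ : σ₀ < σ₁) (hσ₁ : σ₁ < cfDimension A)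
    (hL1 : ∀ s : ℂ, σ₀ < s.re → s ≠ (cfDimension A : ℂ) → IsUnit (1 - cfLOp A hA s))
    (hL2 : ∀ s : ℂ, σ₀ < s.re → IsUnit (1 + cfLOp A hA s))
    (hB : ∀ s : ℂ, σ₀ < s.re → IsUnit (1 - cfTwB A hA q s))
    {κ M : ℝ} (hκ0 : 0 ≤ κ) (hκ : κ < 2) (hM : 0 ≤ M)
    (hop : ∀ u : ℝ, σ₁ ≤ u → u ≤ cfDimension A + 1 → ∀ t : ℝ, (u : ℂ) + t * I ≠ (cfDimension A : ℂ) →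
      ∀ (η : SL(2, ZMod q)) (y : Icc (0 : ℝ) 1),
        ‖(cfTwHop A hA h2 q ((u : ℂ) + t * I) (cfFamS q Θ G ξ₀ ((u : ℂ) + t * I))) η y‖ ≤ M * (1 + |t|) ^ κ)
    (ξ : SL(2, ZMod q)) (x : Icc (0 : ℝ) 1) {X : ℝ} (hX : Real.sqrt 2 ≤ X) :
    |cfCongCountT A Θ G ξ ξ₀ X x - cfCongResid q Θ hA h2 G x * X ^ (2 * cfDimension A) / cfDimension A| ≤
      (cfCongResid q Θ hA h2 G x * (2 ^ (cfDimension A + 1) + 1 / cfDimension A) +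
          (M + Θ.Λ * ‖G‖ * Real.exp (2 * cfDimension A) / cfInt (cfNuδ A hA h2) (cfG A hA h2)) *
            (32 / π * 2 ^ (2 + σ₁) * PerronTwo.shiftConst σ₁ κ)) *
        X ^ (2 * cfDimension A - 2 * ((cfDimension A - σ₁) / 3)) := by
  have hC0 : 0 ≤ Θ.Λ * ‖G‖ * Real.exp (2 * cfDimension A) / cfInt (cfNuδ A hA h2) (cfG A hA h2) := by
    have := Θ.log_nonneg (show (0 : ℝ) ∈ Icc (0 : ℝ) 1 from ⟨le_rfl, zero_le_one⟩)
    have hΛ : 0 ≤ Θ.Λ := this.trans (Θ.log_le 0 ⟨le_rfl, zero_le_one⟩)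
    exact div_nonneg (by positivity) (cfInt_cfG_pos A hA h2).le
  refine cfCongCountT_powerSaving_of_resolventBound q Θ hA h2 hGre hG0 ξ ξ₀ x hσ₀ hσ₀₁ hσ₁ hL1 hL2 hB hκ (by positivity)
    (fun u hu1 hu2 t hne => ?_) hX
  have hs0 : 0 ≤ ((u : ℂ) + t * I).re := by simp; linarith
  refine (norm_cfCongRes_sub_le hA h2 Θ hGre ξ ξ₀ x hs0 hne).trans ?_
  have h1 := hop u hu1 hu2 t hne ξ x
  have h2' : (1 : ℝ) ≤ (1 + |t|) ^ κ := one_le_rpow (by linarith [abs_nonneg t]) hκ0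
  nlinarith [mul_le_mul_of_nonneg_left h2' hC0]

end Operator

end Literature.NumberTheory.Sieve
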